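import Summits.ResolutionOfSingularities.ResolutionOfSingularities.Theorems.ValuativeLuAlphaPTorsorTowerTools
import Summits.ResolutionOfSingularities.ResolutionOfSingularities.Theorems.ValuativeLuAlphaPTorsorTowerBasics
import Mathlib.Algebra.Order.GroupWithZero.Basic
import HarnessLib

/-!
# One `α_p`-step of the tower: a very good chart of `M` gives one of `M(t)`, `t^p ∈ M`

Crux `Valuative.LuAlphaPTorsor` (item `stmt-ResolutionOfSingularities-0641`), line
`pfaff-line-log-final-forms`, reshape v6 (lead seat c4), assembly S6 — the induction step,
MODULO the registered stubs S3 (`stub_perronMonomialization`), S4 (`stub_valueStep`) and S5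
(`stub_residueStep`), which enter as hypotheses (their statements verbatim).

Given a very good chart `(R, x)` of the finitely generated intermediate field `M ⊇ K^{p^e}` along
the rank-one Abhyankar place `O`, and `t` with `t ^ p ∈ M`, `t ∉ M`: take a best approximation
`c₀ ∈ M` of `t` (stability, `exists_bestApprox_of_forall_pow_mem`); write
`(t − c₀)^p = num / den` over `R`, monomialize `num, den` (S3) and invert their unit parts
(`exists_chart_adjoin_inv`), so that `t'' := (t − c₀) · x₁^β` has `t''^p = x₁^{α''} · u''` with
`u'', u''⁻¹` in the chart. If `v(t'')` is not in the lattice of the `v(x₁ᵢ)`, S4 applies (value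
step); otherwise `α'' = p·m`, `t₁ := t''/x₁^m` has `t₁^p = u''` and, `c₀` being a best
approximation, the residue of `t₁` is not a `p`-th power residue of `O ∩ M`
(`valuation_pow_sub_pow_eq_one_of_bestApprox`), so S5 applies (residue step).
-/

set_option linter.dupNamespace false

open IsLocalRing

namespace Summit.ResolutionOfSingularities.ResolutionOfSingularities.Theorems.PfaffLine

open Literature.AlgebraicGeometry.Resolution

variable {k K : Type} [Field k] [Field K] [Algebra k K]

/-! ### Small algebra -/

/-- A non-zero element of `Frac R` is a quotient of two NON-ZERO elements of `R`. [folklore] -/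
theorem exists_num_den_of_mem_closure (R : Subalgebra k K) {a : K}
    (ha : a ∈ Subfield.closure (R : Set K)) (ha0 : a ≠ 0) :
    ∃ num den : K, num ∈ R ∧ den ∈ R ∧ num ≠ 0 ∧ den ≠ 0 ∧ a = num / den := by
  obtain ⟨y, hy, z, hz, rfl⟩ := Subfield.mem_closure_iff.mp ha
  have hcl : Subring.closure (R : Set K) = R.toSubring := Subring.closure_eq R.toSubring
  rw [hcl] at hy hz
  refine ⟨y, z, hy, hz, ?_, ?_, rfl⟩
  · rintro rfl; exact ha0 (by simp)
  · rintro rfl; exact ha0 (by simp)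

/-- `∏ xᵢ^{αᵢ + c βᵢ} = (∏ xᵢ^{αᵢ}) (∏ xᵢ^{βᵢ})^c`. [folklore] -/
theorem prod_pow_add_mul {n : ℕ} (x : Fin n → K) (α β : Fin n → ℕ) (c : ℕ) :
    (∏ i, x i ^ (α i + c * β i)) = (∏ i, x i ^ (α i)) * (∏ i, x i ^ (β i)) ^ c := by
  rw [← Finset.prod_pow, ← Finset.prod_mul_distrib]
  refine Finset.prod_congr rfl fun i _ => ?_
  rw [pow_add, pow_mul']

/-- Valuation of a monomial with natural exponents. [folklore] -/
theorem valuation_prod_pow (O : ValuationSubring K) {n : ℕ} (x : Fin n → K) (α : Fin n → ℕ) :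
    O.valuation (∏ i, x i ^ (α i)) = ∏ i, O.valuation (x i) ^ (α i) := by
  rw [map_prod]
  exact Finset.prod_congr rfl fun i _ => map_pow _ _ _

/-- Valuation of a monomial with natural exponents, as integer powers. [folklore] -/
theorem valuation_prod_pow_zpow (O : ValuationSubring K) {n : ℕ} (x : Fin n → K) (α : Fin n → ℕ) :
    O.valuation (∏ i, x i ^ (α i)) = ∏ i, O.valuation (x i) ^ ((α i : ℤ)) := by
  rw [valuation_prod_pow]
  exact Finset.prod_congr rfl fun i _ => (zpow_natCast _ _).symm

/-- `ℤ`-independence of values as cancellation of exponents. [folklore] -/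
theorem eq_of_prod_zpow_eq (O : ValuationSubring K) {n : ℕ} (x : Fin n → K) (hx0 : ∀ i, x i ≠ 0)
    (hind : ∀ m : Fin n → ℤ, (∏ i, O.valuation (x i) ^ (m i)) = 1 → m = 0)
    (a b : Fin n → ℤ) (h : (∏ i, O.valuation (x i) ^ (a i)) = ∏ i, O.valuation (x i) ^ (b i)) :
    a = b := by
  have hv0 : ∀ i, O.valuation (x i) ≠ 0 := fun i => (map_ne_zero _).mpr (hx0 i)
  have h1 : (∏ i, O.valuation (x i) ^ (a i - b i)) = 1 := by
    have h2 : (∏ i, O.valuation (x i) ^ (a i - b i)) * ∏ i, O.valuation (x i) ^ (b i) =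
        ∏ i, O.valuation (x i) ^ (a i) := by
      rw [← Finset.prod_mul_distrib]
      refine Finset.prod_congr rfl fun i _ => ?_
      rw [← zpow_add₀ (hv0 i), sub_add_cancel]
    have hb0 : (∏ i, O.valuation (x i) ^ (b i)) ≠ 0 :=
      Finset.prod_ne_zero_iff.mpr fun i _ => zpow_ne_zero _ (hv0 i)
    rw [h] at h2
    exact (mul_eq_right₀ hb0).mp h2
  have := hind _ h1
  funext i
  have hi := congrFun this i
  simp only [Pi.zero_apply] at hi
  omega

/-! ### The step -/

/-- **One `α_p`-step**, modulo S3/S4/S5 (their registered statements as hypotheses): a very good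
chart `(R, x)` of the finitely generated intermediate field `M ⊇ K^{p^e}` of the finitely
generated `K/k` of characteristic `p`, along a rank-one Abhyankar place `O ⊇ k`, and `t ∈ K` with
`t ^ p ∈ M` give a very good chart of `M(t) = k(M ∪ {t})` (same number `n` of parameters).
[folklore] -/
theorem exists_chart_adjoin_of_pow_mem
    (hS3 : ∀ (k K : Type) [Field k] [Field K] [Algebra k K] (O : ValuationSubring K) (n : ℕ) (R : Subalgebra k K) (hRO : R.toSubring ≤ O.toSubring) (x : Fin n → K) (hx : ∀ i, x i ∈ R), R.FG → (∀ i, x i ≠ 0) → Ideal.span (Set.range fun i => (⟨x i, hx i⟩ : R.toSubring)) = Ideal.comap (Subring.inclusion hRO) (IsLocalRing.maximalIdeal O) → (∀ m : Fin n → ℤ, (∏ i, O.valuation (x i) ^ (m i)) = 1 → m = 0) → (∀ z w : K, O.valuation z < 1 → w ≠ 0 → ∃ N : ℕ, O.valuation z ^ N < O.valuation w) → ∀ (m : ℕ) (a : Fin m → K), (∀ j, a j ∈ R ∧ a j ≠ 0) → ∀ (l : ℕ) (h : Fin l → Fin n → ℤ), (∀ j, (∏ i, O.valuation (x i) ^ (h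 j i)) ≤ 1) → ∃ (R' : Subalgebra k K) (hR'O : R'.toSubring ≤ O.toSubring) (x' : Fin n → K) (hx' : ∀ i, x' i ∈ R'), R ≤ R' ∧ R'.FG ∧ ((R' : Set K) ⊆ Subfield.closure (R : Set K)) ∧ (∀ i, x' i ≠ 0) ∧ Ideal.span (Set.range fun i => (⟨x' i, hx' i⟩ : R'.toSubring)) = Ideal.comap (Subring.inclusion hR'O) (IsLocalRing.maximalIdeal O) ∧ (∀ m : Fin n → ℤ, (∏ i, O.valuation (x' i) ^ (m i)) = 1 → m = 0) ∧ (∀ i, ∃ d : Fin n → ℕ, x i = ∏ j, x' j ^ (d j)) ∧ (∀ j, ∃ (α : Fin n → ℕ) (u : K), u ∈ R' ∧ O.valuation u = 1 ∧ a j = (∏ i, x' i ^ (α i)) * u) ∧ (∀ j, ∃ e : Fin n → ℕ, (∏ i, x i ^ (h j i)) = ∏ i, x' i ^ (e i)))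
    (hS4 : ∀ p : ℕ, p.Prime → ∀ (k K : Type) [Field k] [Field K] [Algebra k K] (O : ValuationSubring K) (n : ℕ) (R : Subalgebra k K) (hRO : R.toSubring ≤ O.toSubring) (x : Fin n → K) (hx : ∀ i, x i ∈ R), R.FG → (∀ i, x i ≠ 0) → Ideal.span (Set.range fun i => (⟨x i, hx i⟩ : R.toSubring)) = Ideal.comap (Subring.inclusion hRO) (IsLocalRing.maximalIdeal O) → (∀ m : Fin n → ℤ, (∏ i, O.valuation (x i) ^ (m i)) = 1 → m = 0) → ∀ (t u : K) (α : Fin n → ℕ), u ∈ R → u⁻¹ ∈ R → O.valuation u = 1 → t ^ p = (∏ i, x i ^ (α i)) * u → (∀ m : Fin n → ℤ, O.valuation t ≠ ∏ i, O.valuation (x i) ^ (m i)) → ∃ (R' : Subalgebra k K) (hR'O : R'.toSubring ≤ O.toSubring) (y : Fin n → K) (hy : ∀ i, y i ∈ R'), R ≤ R' ∧ t ∈ R' ∧ R'.FG ∧ ((R' : Set K) ⊆ Subfield.closure ((R : Set K) ∪ {t})) ∧ (∀ i, y i ≠ 0) ∧ Ideal.span (Set.range fun i => (⟨y i, hy i⟩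 : R'.toSubring)) = Ideal.comap (Subring.inclusion hR'O) (IsLocalRing.maximalIdeal O) ∧ (∀ m : Fin n → ℤ, (∏ i, O.valuation (y i) ^ (m i)) = 1 → m = 0))
    (hS5 : ∀ p : ℕ, p.Prime → ∀ (k K : Type) [Field k] [Field K] [Algebra k K] (O : ValuationSubring K) (n : ℕ) (R : Subalgebra k K) (hRO : R.toSubring ≤ O.toSubring) (x : Fin n → K) (hx : ∀ i, x i ∈ R), R.FG → Ideal.span (Set.range fun i => (⟨x i, hx i⟩ : R.toSubring)) = Ideal.comap (Subring.inclusion hRO) (IsLocalRing.maximalIdeal O) → ∀ (t u : K), u ∈ R → O.valuation u = 1 → t ^ p = u → (∀ c : K, c ∈ O → c ∈ Subfield.closure (R : Set K) → O.valuation (u - c ^ p) = 1) → ∃ (R' : Subalgebra k K) (hR'O : R'.toSubring ≤ O.toSubring) (hx' : ∀ i, x i ∈ R'), R ≤ R' ∧ t ∈ R' ∧ R'.FG ∧ ((R' : Set K) ⊆ Subfield.closure ((R : Set K) ∪ {t})) ∧ Ideal.span (Set.range fun i => (⟨x i, hx' i⟩ : R'.toSubring)) = Ideal.comap (Subring.inclusion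 hR'O) (IsLocalRing.maximalIdeal O))
    {p : ℕ} (hp : p.Prime) [CharP K p] (O : ValuationSubring K)
    (hk : ∀ c : k, algebraMap k K c ∈ O)
    (hA : IsAbhyankarPlace O (algebraMap k K).fieldRange ⊤)
    (hr1 : ∀ z w : K, O.valuation z < 1 → w ≠ 0 → ∃ N : ℕ, O.valuation z ^ N < O.valuation w)
    (s : Finset K) (hs : IntermediateField.adjoin k (s : Set K) = ⊤)
    (M : IntermediateField k K) (s' : Finset K) (hM' : M = IntermediateField.adjoin k (s' : Set K))
    (e : ℕ) (hMp : ∀ z : K, z ^ p ^ e ∈ M)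
    {n : ℕ} (R : Subalgebra k K) (hRO : R.toSubring ≤ O.toSubring) (x : Fin n → K)
    (hx : ∀ i, x i ∈ R) (hfg : R.FG) (hRM : R ≤ M.toSubalgebra)
    (hMR : (M : Set K) ⊆ Subfield.closure (R : Set K)) (hx0 : ∀ i, x i ≠ 0)
    (hspan : Ideal.span (Set.range fun i => (⟨x i, hx i⟩ : R.toSubring)) =
      Ideal.comap (Subring.inclusion hRO) (maximalIdeal O))
    (hind : ∀ m : Fin n → ℤ, (∏ i, O.valuation (x i) ^ (m i)) = 1 → m = 0)
    (t : K) (htp : t ^ p ∈ M) :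
    ∃ (R' : Subalgebra k K) (hR'O : R'.toSubring ≤ O.toSubring) (x' : Fin n → K)
      (hx' : ∀ i, x' i ∈ R'), R'.FG ∧
      R' ≤ (IntermediateField.adjoin k (insert t (M : Set K))).toSubalgebra ∧
      ((IntermediateField.adjoin k (insert t (M : Set K)) : Set K) ⊆ Subfield.closure (R' : Set K)) ∧
      (∀ i, x' i ≠ 0) ∧
      Ideal.span (Set.range fun i => (⟨x' i, hx' i⟩ : R'.toSubring)) =
        Ideal.comap (Subring.inclusion hR'O) (maximalIdeal O) ∧
      (∀ m : Fin n → ℤ, (∏ i, O.valuation (x' i) ^ (m i)) = 1 → m = 0) := by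
  classical
  haveI : Fact p.Prime := ⟨hp⟩
  set M' : IntermediateField k K := IntermediateField.adjoin k (insert t (M : Set K)) with hM'def
  have hMM' : M ≤ M' := fun z hz => IntermediateField.subset_adjoin k _ (Set.mem_insert_of_mem _ hz)
  have htM' : t ∈ M' := IntermediateField.subset_adjoin k _ (Set.mem_insert _ _)
  -- `M'` is generated by `M ∪ {t}` inside any subfield containing both (and `k`)
  have hM'le : ∀ F : Subfield K, (M : Set K) ⊆ F → t ∈ F → (M' : Set K) ⊆ F := by
    intro F hMF htF z hz
    have h : M' ≤ (IntermediateField.adjoin k (insert t (M : Set K))) := le_rfl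
    have hle : IntermediateField.adjoin k (insert t (M : Set K)) ≤
        F.toIntermediateField (fun c => hMF (M.algebraMap_mem c)) := by
      rw [IntermediateField.adjoin_le_iff]
      exact Set.insert_subset htF hMF
    exact hle hz
  -- ### the trivial case `t ∈ M`
  by_cases htM : t ∈ M
  · have hM'M : (M' : Set K) = M := by
      apply le_antisymm
      · intro z hz
        have hle : M' ≤ M := by
          rw [hM'def, IntermediateField.adjoin_le_iff]
          exact Set.insert_subset htM subset_rfl
        exact hle hz
      · exact fun z hz => hMM' hz
    refine ⟨R, hRO, x, hx, hfg, ?_, ?_, hx0, hspan, hind⟩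
    · intro z hz
      exact hMM' (hRM hz)
    · rw [hM'M]; exact hMR
  -- ### a best approximation `c₀` of `t` from `M`
  obtain ⟨c₀, hc₀M, hbest⟩ :=
    exists_bestApprox_of_forall_pow_mem O hk hA s hs M s' hM' (pow_pos hp.pos e) hMp t
  have ht' : t - c₀ ≠ 0 := fun h => htM (by rw [sub_eq_zero.mp h]; exact hc₀M)
  have ha'M : (t - c₀) ^ p ∈ M := by
    rw [sub_pow_char t c₀]
    exact sub_mem htp (pow_mem hc₀M p)
  have ha'0 : (t - c₀) ^ p ≠ 0 := pow_ne_zero _ ht'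
  -- ### `(t - c₀)^p = num / den` over `R`, monomialized (S3), unit parts inverted
  obtain ⟨num, den, hnumR, hdenR, hnum0, hden0, ha'eq⟩ :=
    exists_num_den_of_mem_closure R (hMR ha'M) ha'0
  let a₂ : Fin 2 → K := ![num, den]
  have ha₂ : ∀ j, a₂ j ∈ R ∧ a₂ j ≠ 0 := fun j => by
    fin_cases j
    · exact ⟨hnumR, hnum0⟩
    · exact ⟨hdenR, hden0⟩
  obtain ⟨R1, hR1O, x1, hx1, hRR1, hfg1, hcl1, hx10, hspan1, hind1, -, hmono, -⟩ :=
    hS3 k K O n R hRO x hx hfg hx0 hspan hind hr1 2 a₂ ha₂ 0 (fun j => Fin.elim0 j)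
      (fun j => Fin.elim0 j)
  obtain ⟨α, ua, huaR1, hua1, hnum⟩ := hmono 0
  obtain ⟨β, ub, hubR1, hub1, hden⟩ := hmono 1
  change num = (∏ i, x1 i ^ α i) * ua at hnum
  change den = (∏ i, x1 i ^ β i) * ub at hden
  have hua0 : ua ≠ 0 := fun h => by rw [h, map_zero] at hua1; exact zero_ne_one hua1
  have hub0 : ub ≠ 0 := fun h => by rw [h, map_zero] at hub1; exact zero_ne_one hub1
  -- invert `ua` and `ub`
  obtain ⟨R1a, hR1aO, hx1a, hR1R1a, huainv, hfg1a, hcl1a, hspan1a⟩ :=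
    exists_chart_adjoin_inv O R1 hR1O x1 hx1 hfg1 hspan1 huaR1 hua1
  obtain ⟨R2, hR2O, hx2, hR1aR2, hubinv, hfg2, hcl2, hspan2⟩ :=
    exists_chart_adjoin_inv O R1a hR1aO x1 hx1a hfg1a hspan1a (hR1R1a hubR1) hub1
  have hR1R2 : R1 ≤ R2 := hR1R1a.trans hR1aR2
  have hRR2 : R ≤ R2 := hRR1.trans hR1R2
  -- fraction fields: `R2 ⊆ Frac R1 ⊆ Frac R ⊆ M`
  have hclRM : Subfield.closure (R : Set K) ≤ M.toSubfield :=
    Subfield.closure_le.mpr fun z hz => hRM hz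
  have hclR1R : Subfield.closure (R1 : Set K) ≤ Subfield.closure (R : Set K) :=
    Subfield.closure_le.mpr hcl1
  have hclR1aR1 : Subfield.closure (R1a : Set K) ≤ Subfield.closure (R1 : Set K) :=
    Subfield.closure_le.mpr hcl1a
  have hR2M : ∀ z ∈ R2, z ∈ M := fun z hz => hclRM (hclR1R (hclR1aR1 (hcl2 hz)))
  have hclR2M : Subfield.closure (R2 : Set K) ≤ M.toSubfield :=
    Subfield.closure_le.mpr fun z hz => hR2M z hz
  have hx1M : ∀ i, x1 i ∈ M := fun i => hR2M _ (hx2 i)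
  have hMclR2 : (M : Set K) ⊆ Subfield.closure (R2 : Set K) := fun z hz =>
    Subfield.closure_mono (fun w hw => hRR2 hw) (hMR hz)
  -- ### `t'' := (t − c₀) x₁^β`, `u'' := ua / ub`, `α'' := α + (p − 1) β`
  set PB : K := ∏ i, x1 i ^ β i with hPB
  set PA : K := ∏ i, x1 i ^ α i with hPA
  have hPB0 : PB ≠ 0 := Finset.prod_ne_zero_iff.mpr fun i _ => pow_ne_zero _ (hx10 i)
  have hPBM : PB ∈ M := M.toSubalgebra.prod_mem fun i _ => M.toSubalgebra.pow_mem (hx1M i) _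
  set t'' : K := (t - c₀) * PB with ht''def
  set u'' : K := ua * ub⁻¹ with hu''def
  let α'' : Fin n → ℕ := fun i => α i + (p - 1) * β i
  have hu''R2 : u'' ∈ R2 := R2.mul_mem (hR1R2 huaR1) hubinv
  have hu''inv : u''⁻¹ ∈ R2 := by
    rw [hu''def, mul_inv, inv_inv]
    exact R2.mul_mem (hR1aR2 huainv) (hR1R2 hubR1)
  have hu''1 : O.valuation u'' = 1 := by
    rw [hu''def, map_mul, map_inv₀, hua1, hub1, inv_one, mul_one]
  have hPα'' : (∏ i, x1 i ^ α'' i) = PA * PB ^ (p - 1) := prod_pow_add_mul x1 α β (p - 1)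
  have ht''p : t'' ^ p = (∏ i, x1 i ^ α'' i) * u'' := by
    rw [hPα'', ht''def, mul_pow, ha'eq, hnum, hden, hu''def]
    have hp1 : p = (p - 1) + 1 := (Nat.sub_add_cancel hp.one_le).symm
    conv_lhs => rw [hp1]
    rw [pow_succ]
    field_simp
  -- ### the dichotomy on `v(t'')`
  by_cases hval : ∃ m : Fin n → ℤ, O.valuation t'' = ∏ i, O.valuation (x1 i) ^ (m i)
  · -- #### residue step: `α'' = p m`, `t₁ := t'' / x₁^m`, `t₁^p = u''`
    obtain ⟨m, hm⟩ := hval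
    have hpm : (fun i => (p : ℤ) * m i) = fun i => (α'' i : ℤ) := by
      apply eq_of_prod_zpow_eq O x1 hx10 hind1
      have h1 : O.valuation (t'' ^ p) = ∏ i, O.valuation (x1 i) ^ ((p : ℤ) * m i) := by
        rw [map_pow, hm, ← Finset.prod_pow]
        refine Finset.prod_congr rfl fun i _ => ?_
        rw [← zpow_natCast, ← zpow_mul, mul_comm]
      have h2 : O.valuation (t'' ^ p) = ∏ i, O.valuation (x1 i) ^ ((α'' i : ℤ)) := by
        rw [ht''p, map_mul, hu''1, mul_one, valuation_prod_pow_zpow]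
      rw [← h1, ← h2]
    have hmi : ∀ i, (p : ℤ) * m i = α'' i := fun i => congrFun hpm i
    have hm0 : ∀ i, 0 ≤ m i := fun i => by
      have h := hmi i
      have hp0 : (0 : ℤ) < p := by exact_mod_cast hp.pos
      nlinarith [Int.natCast_nonneg (α'' i)]
    let mN : Fin n → ℕ := fun i => (m i).toNat
    have hmN : ∀ i, α'' i = p * mN i := fun i => by
      have h := hmi i
      have h2 : ((mN i : ℕ) : ℤ) = m i := Int.toNat_of_nonneg (hm0 i)
      have : ((α'' i : ℕ) : ℤ) = ((p * mN i : ℕ) : ℤ) := by push_cast; rw [h2]; exact h.symm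
      exact_mod_cast this
    set PM : K := ∏ i, x1 i ^ mN i with hPM
    have hPM0 : PM ≠ 0 := Finset.prod_ne_zero_iff.mpr fun i _ => pow_ne_zero _ (hx10 i)
    have hPMM : PM ∈ M := M.toSubalgebra.prod_mem fun i _ => M.toSubalgebra.pow_mem (hx1M i) _
    have hPMp : PM ^ p = ∏ i, x1 i ^ α'' i := by
      rw [hPM, ← Finset.prod_pow]
      refine Finset.prod_congr rfl fun i _ => ?_
      rw [← pow_mul, mul_comm, ← hmN]
    set t₁ : K := t'' / PM with ht₁def
    have ht₁p : t₁ ^ p = u'' := by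
      rw [ht₁def, div_pow, hPMp, ht''p]
      exact mul_div_cancel_left₀ _
        (Finset.prod_ne_zero_iff.mpr fun i _ => pow_ne_zero _ (hx10 i))
    -- `t₁ = w (t − c₀)` with `w = PB / PM ∈ M`, a unit
    set w : K := PB / PM with hwdef
    have hwM : w ∈ M := div_mem hPBM hPMM
    have ht₁w : t₁ = w * (t - c₀) := by
      rw [ht₁def, ht''def, hwdef]
      field_simp
    have hunit : O.valuation (w * (t - c₀)) = 1 := by
      rw [← ht₁w]
      have h : O.valuation t₁ ^ p = 1 := by rw [← map_pow, ht₁p, hu''1]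
      exact (pow_eq_one_iff_of_nonneg zero_le hp.ne_zero).mp h
    have hres : ∀ c : K, c ∈ O → c ∈ Subfield.closure (R2 : Set K) →
        O.valuation (u'' - c ^ p) = 1 := by
      intro c hcO hcR2
      have h := valuation_pow_sub_pow_eq_one_of_bestApprox (k := k) (p := p) O M hc₀M hwM hbest
        hunit c hcO (hclR2M hcR2)
      rwa [← ht₁w, ht₁p] at h
    obtain ⟨R3, hR3O, hx3, hR2R3, ht₁R3, hfg3, hcl3, hspan3⟩ :=
      hS5 p hp k K O n R2 hR2O x1 hx2 hfg2 hspan2 t₁ u'' hu''R2 hu''1 ht₁p hres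
    have hw0 : w ≠ 0 := div_ne_zero hPB0 hPM0
    have htR3 : t = t₁ / w + c₀ := by
      rw [ht₁w]; field_simp; ring
    refine ⟨R3, hR3O, x1, hx3, hfg3, ?_, ?_, hx10, hspan3, hind1⟩
    · -- `R3 ⊆ M(t)`
      intro z hz
      have hF : (R2 : Set K) ∪ {t₁} ⊆ (M'.toSubfield : Set K) := by
        rintro y (hy | hy)
        · exact hMM' (hR2M y hy)
        · rw [Set.mem_singleton_iff.mp hy, ht₁w]
          exact M'.mul_mem (hMM' hwM) (M'.sub_mem htM' (hMM' hc₀M))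
      exact (Subfield.closure_le.mpr hF) (hcl3 hz)
    · -- `M(t) ⊆ Frac R3`
      refine hM'le _ (fun z hz => Subfield.closure_mono (fun y hy => hR2R3 (hRR2 hy)) (hMR hz)) ?_
      rw [htR3]
      refine add_mem (div_mem (Subfield.subset_closure ht₁R3) ?_) ?_
      · exact Subfield.closure_mono (fun y hy => hR2R3 (hRR2 hy)) (hMR hwM)
      · exact Subfield.closure_mono (fun y hy => hR2R3 (hRR2 hy)) (hMR hc₀M)
  · -- #### value step
    push Not at hval
    obtain ⟨R3, hR3O, y, hy, hR2R3, ht''R3, hfg3, hcl3, hy0, hspan3, hind3⟩ :=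
      hS4 p hp k K O n R2 hR2O x1 hx2 hfg2 hx10 hspan2 hind1 t'' u'' α'' hu''R2 hu''inv hu''1
        ht''p hval
    have htR3 : t = t'' / PB + c₀ := by
      rw [ht''def]; field_simp; ring
    refine ⟨R3, hR3O, y, hy, hfg3, ?_, ?_, hy0, hspan3, hind3⟩
    · intro z hz
      have hF : (R2 : Set K) ∪ {t''} ⊆ (M'.toSubfield : Set K) := by
        rintro w (hw | hw)
        · exact hMM' (hR2M w hw)
        · rw [Set.mem_singleton_iff.mp hw, ht''def]
          exact M'.mul_mem (M'.sub_mem htM' (hMM' hc₀M)) (hMM' hPBM)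
      exact (Subfield.closure_le.mpr hF) (hcl3 hz)
    · refine hM'le _ (fun z hz => Subfield.closure_mono (fun y hy => hR2R3 (hRR2 hy)) (hMR hz)) ?_
      rw [htR3]
      refine add_mem (div_mem (Subfield.subset_closure ht''R3) ?_) ?_
      · exact Subfield.closure_mono (fun y hy => hR2R3 (hRR2 hy)) (hMR hPBM)
      · exact Subfield.closure_mono (fun y hy => hR2R3 (hRR2 hy)) (hMR hc₀M)

/-- **`ℤ`-independence of values as cancellation of exponents** (registered sub-goal form of
`eq_of_prod_zpow_eq`, binders explicit). [folklore] -/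
theorem valIndep_exponent_cancel :
    ∀ (K : Type) [Field K] (O : ValuationSubring K) (n : ℕ) (x : Fin n → K), (∀ i, x i ≠ 0) → (∀ m : Fin n → ℤ, (∏ i, O.valuation (x i) ^ (m i)) = 1 → m = 0) → ∀ (a b : Fin n → ℤ), (∏ i, O.valuation (x i) ^ (a i)) = ∏ i, O.valuation (x i) ^ (b i) → a = b := by
  intro K _ O n x hx0 hind a b h
  exact eq_of_prod_zpow_eq O x hx0 hind a b h

end Summit.ResolutionOfSingularities.ResolutionOfSingularities.Theorems.PfaffLine
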